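import Literature.AlgebraicGeometry.HodgeTheory.HodgeSheafComapIso
import Literature.AlgebraicGeometry.HodgeTheory.MultiHomPushforward
import Literature.AlgebraicGeometry.HodgeTheory.MultiHomMapIso
import Literature.AlgebraicGeometry.Deformation.IdealModulePushforward
import Literature.AlgebraicGeometry.Modules.PushforwardIsoAdjunction
import Literature.AlgebraicGeometry.Modules.PushforwardIsoCohomology
import HarnessLib

/-!
# Bloch semiregularity is invariant under isomorphisms of the ambient scheme

Layer `Literature/AlgebraicGeometry/HodgeTheory`; closes the transport of Bloch's semiregularity
pairing (`BlochSemiregularityMapReal.lean`: `blochPairingAltSheafHom i r j : Ωʲ_X ⟶ 𝓐lt_r(𝓘; Ωᴺ|_Z)`,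
`blochPairingMap` on cohomology, `IsBlochSemiregular i n p`) along an isomorphism `e : X₀ ≅ X₁` of
`S`-schemes (`ψ := e.hom.left`, `Z ⊂ X₀` via `i`, `Z ⊂ X₁` via `i ≫ ψ`). Everything PROVED, no named
facts:

* `multiHom_ext_of_evalMulti` — sections of the iterated internal Hom are determined by their values
  on tuples;
* `formsOnSubscheme.pushforwardIso e i N : Ωᴺ|_Z (via i ≫ ψ) ≅ ψ_* (Ωᴺ|_Z via i)` compatibly with
  `restrictForms` (`Modules/PushforwardIsoAdjunction` + `HodgeSheafComapIso`);
* `altTargetComparison e i r j : 𝓐lt_r(𝓘_{i≫ψ}; Ωᴺ|_Z) ⟶ ψ_* 𝓐lt_r(𝓘_i; Ωᴺ|_Z)`, an isomorphism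
  (`MultiHomMapIso` along `Deformation/IdealModulePushforward` and the previous item, then
  `MultiHomPushforward`);
* **`blochPairingAltSheafHom_comp_altTargetComparison`** — NATURALITY of Bloch's pairing:
  `pairing_{i≫ψ} ≫ altTargetComparison = Λʲψ^♯ ≫ ψ_*(pairing_i)` (checked on local wedge forms and on
  tuples of ideal sections: `d(ψ♯ a) = ψ^♯(da)`, `ψ^♯` multiplicative on wedges, restriction to `Z`);
* **`blochPairingMap_surjective_comp_iso`**, **`IsBlochSemiregular.comp_iso`** — by the cohomology of
  push-forward along an isomorphism (`Modules/PushforwardIsoCohomology`).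

Motivation (venture HSemireg, bridge (B1)): this is the displayed premise `hT` of the capstone
`Summits/Ventures/HSemireg/BlochSpreadOfObjectLevel.lean`, which thereby becomes unconditional in it.

References: S. Bloch, *Semi-regularity and de Rham cohomology*, Invent. Math. 17 (1972), §4 (the
semiregularity map is intrinsic to the pair `Z ⊂ X`); R.-O. Buchweitz, H. Flenner, *A semiregularity
map for modules…* (2003), (8.1); R. Hartshorne, *Algebraic Geometry* (1977), II §5, II 8.10–8.11,
III 2.10. The statements are the bookkeeping of these constructions along an isomorphism (reading).
[Bloch1972Semiregularity] [BuchweitzFlenner2003] [Hartshorne1977]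
-/

noncomputable section

-- `TopCat.Presheaf`/`Scheme.Modules` are not reducible (as in Mathlib's `AlgebraicGeometry/Modules/Sheaf.lean`).
set_option backward.isDefEq.respectTransparency false

open CategoryTheory AlgebraicGeometry Opposite TopologicalSpace

universe u

namespace Literature.AlgebraicGeometry.HodgeTheory

open Literature.AlgebraicGeometry.Modules Literature.AlgebraicGeometry.Motives
  Literature.AlgebraicGeometry.Deformation

/-! ### Sections of `multiHom` are determined by their values on tuples -/

section Ext

variable {Y : Scheme.{u}} (I T : Y.Modules)

/-- Restricting a section along the identity. [folklore] -/
private theorem presheaf_map_id_apply (M : Y.Modules) {U : Y.Opens} (s : Γ(M, U)) :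
    M.presheaf.map (𝟙 U).op s = s := by
  rw [op_id, CategoryTheory.Functor.map_id]; rfl

/-- `evalMulti` of a value `φ(s)` on a tuple `a'` is `evalMulti` of `φ` on the tuple `(a', s|)`. [cite: BuchweitzFlenner2003, (8.1) (the pairing; reading: its naturality under isomorphisms of the ambient scheme)] -/
theorem evalMulti_appLE_multiHomSucc (r : ℕ) {U W W' : Y.Opens} (ψ : Γ(multiHom I T (r + 1), U))
    (k : W ⟶ U) (s : Γ(I, W)) (k' : W' ⟶ W) (a' : Fin r → Γ(I, W')) :
    evalMulti I T r (appLE (multiHomSucc I T r ψ) k s) k' a' =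
      evalMulti I T (r + 1) ψ (k' ≫ k) (Fin.snoc a' (I.presheaf.map k'.op s)) := by
  rw [evalMulti_succ, Fin.snoc_last, Fin.init_snoc, appLE_map, evalMulti_map, Category.id_comp]

/-- **Two sections of `multiHom I T r` with the same values on all tuples are equal.** [cite: BuchweitzFlenner2003, (8.1) (the pairing; reading: its naturality under isomorphisms of the ambient scheme)] -/
theorem multiHom_ext_of_evalMulti : (r : ℕ) → ∀ {U : Y.Opens} (φ φ' : Γ(multiHom I T r, U)),
    (∀ ⦃W : Y.Opens⦄ (k : W ⟶ U) (a : Fin r → Γ(I, W)),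
      evalMulti I T r φ k a = evalMulti I T r φ' k a) → φ = φ'
  | 0, U, φ, φ', h => by
    have h0 := h (𝟙 U) Fin.elim0
    rw [evalMulti_zero, evalMulti_zero] at h0
    change T.presheaf.map (𝟙 U).op φ = T.presheaf.map (𝟙 U).op φ' at h0
    rwa [presheaf_map_id_apply, presheaf_map_id_apply] at h0
  | r + 1, U, φ, φ', h => by
    change multiHomSucc I T r φ = multiHomSucc I T r φ'
    refine hom_ext_of_appLE fun W k s => multiHom_ext_of_evalMulti r _ _ fun W' k' a' => ?_
    rw [evalMulti_appLE_multiHomSucc, evalMulti_appLE_multiHomSucc, h]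

end Ext

/-! ### `Ωᴺ|_Z` under an isomorphism of the ambient scheme -/

section FormsPushforward

variable {S : Type u} [CommRing S] {X₀ X₁ : Over (Spec (CommRingCat.of S))} (e : X₀ ≅ X₁)
  {Z : Scheme.{u}} (i : Z ⟶ X₀.left) (N : ℕ)

/-- The isomorphism of underlying schemes of an isomorphism of `S`-schemes, spelled so that
`(leftIso e).hom` is `e.hom.left` definitionally. [folklore] -/
abbrev leftIso : X₀.left ≅ X₁.left :=
  ⟨e.hom.left, e.inv.left, by rw [← Over.comp_left, e.hom_inv_id, Over.id_left],
    by rw [← Over.comp_left, e.inv_hom_id, Over.id_left]⟩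

/-- **`Ωᴺ|_Z` transports along an isomorphism of the ambient scheme**:
`formsOnSubscheme (i ≫ e) N = (i ≫ e)_* (i ≫ e)^* Ωᴺ_{X₁} ≅ e_* i_* i^* Ωᴺ_{X₀} = e_* (formsOnSubscheme i N)`
(`Modules.pushforwardPullbackCompIso` with `a = hodgeSheaf.comapIso e N`).
[cite: Hartshorne1977, II §5 p. 110 with II Ex. 5.16 (e) and II Prop. 8.11 (reading: Ωᴺ|_Z along an isomorphism of the ambient scheme)] -/
def formsOnSubscheme.pushforwardIso :
    formsOnSubscheme (i ≫ e.hom.left) N ≅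
      (Scheme.Modules.pushforward e.hom.left).obj (formsOnSubscheme i N) :=
  Modules.pushforwardPullbackCompIso i (leftIso e) (hodgeSheaf.comapIso e N)

/-- **Compatibility with the restriction of forms**. 
[cite: Hartshorne1977, II §5 p. 110 with II Ex. 5.16 (e) and II Prop. 8.11 (reading: Ωᴺ|_Z along an isomorphism of the ambient scheme)] -/
theorem restrictForms_comp_pushforwardIso_hom :
    restrictForms (i ≫ e.hom.left) N ≫ (formsOnSubscheme.pushforwardIso e i N).hom =
      (hodgeSheaf.comapIso e N).hom ≫ (Scheme.Modules.pushforward e.hom.left).map (restrictForms i N) :=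
  Modules.unit_comp_pushforwardPullbackCompIso_hom i (leftIso e) (hodgeSheaf.comapIso e N)

/-- Sectionwise form of `restrictForms_comp_pushforwardIso_hom` on a local wedge form. [cite: BuchweitzFlenner2003, (8.1) (the pairing; reading: its naturality under isomorphisms of the ambient scheme)] -/
theorem pushforwardIso_hom_app_restrictForms_app (U : X₁.left.Opens)
    (η : ((formsOne X₁).obj (op U)).exteriorPower N) :
    (formsOnSubscheme.pushforwardIso e i N).hom.app U
        ((restrictForms (i ≫ e.hom.left) N).app U ((toHodgeSheaf X₁ N).app (op U) η)) =
      ((restrictForms i N).app (e.hom.left ⁻¹ᵁ U)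
        ((toHodgeSheaf X₀ N).app (op (e.hom.left ⁻¹ᵁ U)) (comapWedge e.hom N U η)) :
          Γ(formsOnSubscheme i N, e.hom.left ⁻¹ᵁ U)) := by
  have h := congrArg (fun f => Scheme.Modules.Hom.app f U ((toHodgeSheaf X₁ N).app (op U) η))
    (restrictForms_comp_pushforwardIso_hom e i N)
  simp only [Scheme.Modules.Hom.comp_app, CategoryTheory.comp_apply] at h
  rw [h, hodgeSheaf.comapIso_hom, hodgeSheaf.comap_app_toHodgeSheaf]
  rfl

end FormsPushforward

/-! ### Naturality of Bloch's pairing under an isomorphism of the ambient scheme -/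

section Naturality

variable {S : Type u} [CommRing S] {X₀ X₁ : Over (Spec (CommRingCat.of S))} (e : X₀ ≅ X₁)
  {Z : Scheme.{u}} (i : Z ⟶ X₀.left) (r j : ℕ)

/-- Shorthand: `ψ_*` for `ψ = e.hom.left`. [folklore] -/
abbrev push : X₀.left.Modules ⥤ X₁.left.Modules := Scheme.Modules.pushforward e.hom.left

/-- `𝓘_{i ≫ ψ} ≅ ψ_* 𝓘_i`. [folklore] -/
abbrev idealIso : idealModule (i ≫ e.hom.left) ≅ (push e).obj (idealModule i) :=
  idealModulePushforwardIso i (leftIso e)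

/-- The comparison `𝓐lt_r(𝓘_{i≫ψ}; Ωᴺ|_Z) ⟶ ψ_* 𝓐lt_r(𝓘_i; Ωᴺ|_Z)` (an isomorphism): change of inputs along
`idealIso`, `formsOnSubscheme.pushforwardIso`, then the inverse of `altMultiHomPushforwardIso`. [folklore] -/
def altTargetComparison :
    altMultiHom (idealModule (i ≫ e.hom.left)) (formsOnSubscheme (i ≫ e.hom.left) (pairingDegree r j)) r ⟶
      (push e).obj (altMultiHom (idealModule i) (formsOnSubscheme i (pairingDegree r j)) r) :=
  (altMultiHomMapIso (idealIso e i) (formsOnSubscheme.pushforwardIso e i (pairingDegree r j)) r).hom ≫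
    (altMultiHomPushforwardIso (leftIso e) (idealModule i) (formsOnSubscheme i (pairingDegree r j)) r).inv

/-- `altTargetComparison` is an isomorphism. [folklore] -/
instance isIso_altTargetComparison : IsIso (altTargetComparison e i r j) := by
  unfold altTargetComparison; infer_instance

/-- `altTargetComparison ≫ ψ_*(altι) = altι ≫ μ.hom ≫ κ.inv`. [cite: BuchweitzFlenner2003, (8.1) (the pairing; reading: its naturality under isomorphisms of the ambient scheme)] -/
theorem altTargetComparison_comp_map_altι :
    altTargetComparison e i r j ≫ (push e).map (altι _ _ r) =
      altι _ _ r ≫ (multiHomMapIso (idealIso e i) (formsOnSubscheme.pushforwardIso e i (pairingDegree r j)) r).hom ≫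
        (multiHomPushforwardIso (leftIso e) (idealModule i) (formsOnSubscheme i (pairingDegree r j)) r).inv := by
  have hPF : (altMultiHomPushforwardIso (leftIso e) (idealModule i)
        (formsOnSubscheme i (pairingDegree r j)) r).inv ≫ (push e).map (altι _ _ r) =
      altι _ _ r ≫ (multiHomPushforwardIso (leftIso e) (idealModule i)
        (formsOnSubscheme i (pairingDegree r j)) r).inv := by
    rw [Iso.inv_comp_eq, ← Category.assoc, Iso.eq_comp_inv]
    exact (altMultiHomPushforwardHom_comp_altι (leftIso e) (idealModule i)
      (formsOnSubscheme i (pairingDegree r j)) r).symm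
  rw [altTargetComparison, Category.assoc, hPF, ← Category.assoc]
  change (altMultiHomMapHom _ _ r ≫ altι _ _ r) ≫ _ = _
  rw [altMultiHomMapHom_comp_altι, Category.assoc]

/-- `ψ♯` of `ι(α⁻¹ a)` is `ι(a)` read over `ψ⁻¹W`: the ideal sections match under `idealIso`. [cite: BuchweitzFlenner2003, (8.1) (the pairing; reading: its naturality under isomorphisms of the ambient scheme)] -/
theorem app_idealModuleι_idealIso_inv (W : X₁.left.Opens) (a : Γ((push e).obj (idealModule i), W)) :
    e.hom.left.app W ((idealModuleι (i ≫ e.hom.left)).app W ((idealIso e i).inv.app W a)) =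
      ((idealModuleι i).app (e.hom.left ⁻¹ᵁ W) (show Γ(idealModule i, e.hom.left ⁻¹ᵁ W) from a)) := by
  have h := (idealModuleι_app_idealModulePushforwardIso_hom_app i (leftIso e) W
    ((idealIso e i).inv.app W a)).symm
  have h2 : (idealIso e i).hom.app W ((idealIso e i).inv.app W a) = a := by
    change (((idealIso e i).inv ≫ (idealIso e i).hom).app W) a = a
    rw [Iso.inv_hom_id, Scheme.Modules.Hom.id_app]; rfl
  rw [h2] at h
  exact h

/-- **Naturality of Bloch's pairing under an isomorphism `e : X₀ ≅ X₁` of the ambient scheme**: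
`pairing_{i≫ψ} ≫ altTargetComparison = Λʲψ^♯ ≫ ψ_*(pairing_i)`. [cite: BuchweitzFlenner2003, (8.1) (the pairing; reading: its naturality under isomorphisms of the ambient scheme)] -/
theorem blochPairingAltSheafHom_comp_altTargetComparison :
    blochPairingAltSheafHom (i ≫ e.hom.left) r j ≫ altTargetComparison e i r j =
      (hodgeSheaf.comapIso e j).hom ≫ (push e).map (blochPairingAltSheafHom i r j) := by
  -- after the mono `ψ_*(altι)`
  have hmono : ∀ {F : X₁.left.Modules} (f g : F ⟶ (push e).obj (altMultiHom (idealModule i)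
      (formsOnSubscheme i (pairingDegree r j)) r)),
      f ≫ (push e).map (altι _ _ r) = g ≫ (push e).map (altι _ _ r) → f = g := by
    intro F f g hfg
    refine Scheme.Modules.hom_ext _ _ fun U => ?_
    ext x
    have hx := congrArg (fun φ => Scheme.Modules.Hom.app φ U x) hfg
    simp only [Scheme.Modules.Hom.comp_app, CategoryTheory.comp_apply] at hx
    exact altι_app_injective (idealModule i) (formsOnSubscheme i (pairingDegree r j)) r
      (e.hom.left ⁻¹ᵁ U) hx
  apply hmono
  rw [Category.assoc, altTargetComparison_comp_map_altι, ← Category.assoc,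
    blochPairingAltSheafHom_comp_altι, Category.assoc, ← Functor.map_comp,
    blochPairingAltSheafHom_comp_altι]
  -- on local wedge forms
  apply hodgeSheaf.hom_ext_toHodgeSheaf
  intro U ω
  simp only [Scheme.Modules.Hom.comp_app, CategoryTheory.comp_apply]
  -- apply the injective `κ.hom.app U`
  set κ := multiHomPushforwardIso (leftIso e) (idealModule i) (formsOnSubscheme i (pairingDegree r j)) r
  set μ := multiHomMapIso (idealIso e i) (formsOnSubscheme.pushforwardIso e i (pairingDegree r j)) r
  have hκ : Function.Injective (κ.hom.app U) := (ConcreteCategory.bijective_of_isIso (κ.hom.app U)).1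
  apply hκ
  have h1 : κ.hom.app U (κ.inv.app U (μ.hom.app U ((blochPairingSheafHom (i ≫ e.hom.left) r j).app U
      ((toHodgeSheaf X₁ j).app (op U) ω)))) =
      μ.hom.app U ((blochPairingSheafHom (i ≫ e.hom.left) r j).app U ((toHodgeSheaf X₁ j).app (op U) ω)) := by
    change ((κ.inv ≫ κ.hom).app U) _ = _
    rw [Iso.inv_hom_id, Scheme.Modules.Hom.id_app]; rfl
  rw [h1, hodgeSheaf.comapIso_hom, hodgeSheaf.comap_app_toHodgeSheaf]
  -- compare values on tuples
  refine multiHom_ext_of_evalMulti _ _ r _ _ fun W k a => ?_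
  rw [evalMulti_multiHomMapIso_hom_app, evalMulti_blochPairingSheafHom_app]
  erw [evalMulti_multiHomPushforwardIso_hom_app (leftIso e) (idealModule i)
    (formsOnSubscheme i (pairingDegree r j)) r]
  change _ = evalMulti (idealModule i) (formsOnSubscheme i (pairingDegree r j)) r
    ((blochPairingSheafHom i r j).app (e.hom.left ⁻¹ᵁ U)
      ((toHodgeSheaf X₀ j).app (op (e.hom.left ⁻¹ᵁ U)) (comapWedge e.hom j U ω))) _ _
  rw [evalMulti_blochPairingSheafHom_app]
  change (formsOnSubscheme.pushforwardIso e i (pairingDegree r j)).hom.app W _ = _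
  rw [← restrWedge_apply, pushforwardIso_hom_app_restrictForms_app]
  congr 2
  rw [show comapWedge e.hom (pairingDegree r j) W
      (wedgeIter ((formsOne X₁).obj (op W)) r j _ (restrWedge j k ω)) =
    exteriorPowerMap' (comapOneApp e.hom W) (pairingDegree r j) (wedgeIter _ r j _ _) from rfl,
    exteriorPowerMap'_wedgeIter, ← restrWedge_apply]
  change wedgeIter _ r j _ (comapWedge e.hom j W (restrWedge j k ω)) =
    wedgeIter _ r j _ (restrWedge j ((Opens.map e.hom.left.base).map k) (comapWedge e.hom j U ω))
  rw [← restrWedge_comapWedge]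
  congr 1
  funext s
  change comapOneApp e.hom W (dSection X₁ W _) = dSection X₀ _ _
  change (cotangentSheaf.comap e.hom).app W (dSection X₁ W _) = _
  rw [comap_app_dSection]
  congr 1
  exact app_idealModuleι_idealIso_inv e i W (a s)

end Naturality

/-! ### Bloch semiregularity is invariant under isomorphisms of the ambient scheme -/

section CompIso

variable {S : Type u} [CommRing S] {X₀ X₁ : Over (Spec (CommRingCat.of S))} (e : X₀ ≅ X₁)
  {Z : Scheme.{u}} (i : Z ⟶ X₀.left)

/-- `H^k` of a composite of module maps is the composite (Mathlib's `Sheaf.H.map_comp_apply` through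
the functor `toSheaf`). [folklore] -/
private theorem moduleSheafCohomology_map_comp_apply {Y : Scheme.{u}} {L L' L'' : Y.Modules}
    (f : L ⟶ L') (g : L' ⟶ L'') (k : ℕ) (x : moduleSheafCohomology L k) :
    moduleSheafCohomology.map (f ≫ g) k x =
      moduleSheafCohomology.map g k (moduleSheafCohomology.map f k x) := by
  change Sheaf.H.map ((SheafOfModules.toSheaf Y.ringCatSheaf).map (f ≫ g)) k x = _
  rw [Functor.map_comp, Sheaf.H.map_comp_apply]

/-- **Bloch's pairing on cohomology under an isomorphism of the ambient scheme**: surjectivity of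
`H^k(X₁, Ωʲ) → H^k(X₁, 𝓐lt_r(𝓘_{i≫ψ}; Ωᴺ|_Z))` follows from that of
`H^k(X₀, Ωʲ) → H^k(X₀, 𝓐lt_r(𝓘_i; Ωᴺ|_Z))` (`ψ = e.hom.left`).
[cite: Bloch1972Semiregularity, §1 p. 52 (the semi-regularity map π : H¹(Z, N_{Z/X}) → H^{p+1}(X, Ω^{p−1}_X); §0 p. 51; reading: π is intrinsic to the pair Z ⊂ X, hence invariant under isomorphisms of the pair)] -/
theorem blochPairingMap_surjective_comp_iso (r j k : ℕ)
    (h : Function.Surjective (blochPairingMap i r j k)) :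
    Function.Surjective (blochPairingMap (i ≫ e.hom.left) r j k) := by
  -- the square on cohomology
  have hsq : ∀ x, moduleSheafCohomology.map (altTargetComparison e i r j) k
      (blochPairingMap (i ≫ e.hom.left) r j k x) =
      moduleSheafCohomology.map ((push e).map (blochPairingAltSheafHom i r j)) k
        (moduleSheafCohomology.map (hodgeSheaf.comapIso e j).hom k x) := by
    intro x
    change moduleSheafCohomology.map (altTargetComparison e i r j) k
      (moduleSheafCohomology.map (blochPairingAltSheafHom (i ≫ e.hom.left) r j) k x) = _
    rw [← moduleSheafCohomology_map_comp_apply, ← moduleSheafCohomology_map_comp_apply,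
      blochPairingAltSheafHom_comp_altTargetComparison]
  -- surjectivity of the composite
  have h1 : Function.Surjective (moduleSheafCohomology.map
      ((push e).map (blochPairingAltSheafHom i r j)) k) :=
    (surjective_H_map_modulesPushforward_iff (leftIso e) (blochPairingAltSheafHom i r j) k).mpr h
  have h2 : Function.Surjective (moduleSheafCohomology.map (hodgeSheaf.comapIso e j).hom k) :=
    (moduleSheafCohomology_map_bijective (hodgeSheaf.comapIso e j).hom k).2
  have h3 : Function.Surjective (moduleSheafCohomology.map (altTargetComparison e i r j) k ∘
      blochPairingMap (i ≫ e.hom.left) r j k) := by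
    rw [show moduleSheafCohomology.map (altTargetComparison e i r j) k ∘
        blochPairingMap (i ≫ e.hom.left) r j k =
      moduleSheafCohomology.map ((push e).map (blochPairingAltSheafHom i r j)) k ∘
        moduleSheafCohomology.map (hodgeSheaf.comapIso e j).hom k from funext hsq]
    exact h1.comp h2
  exact Function.Surjective.of_comp_left h3
    (moduleSheafCohomology_map_bijective (altTargetComparison e i r j) k).1

/-- **Bloch semiregularity is invariant under isomorphisms of the ambient `S`-scheme**: if
`Z ⊂ X₀` (via `i`) is semiregular in Bloch's sense and `e : X₀ ≅ X₁`, then `Z ⊂ X₁` (via `i ≫ e`) is.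
This is the premise `hT` of the HSemireg capstone `BlochSpreadOfObjectLevel`, now a theorem.
[cite: Bloch1972Semiregularity, §1 p. 52 (the semi-regularity map π : H¹(Z, N_{Z/X}) → H^{p+1}(X, Ω^{p−1}_X); §0 p. 51; reading: π is intrinsic to the pair Z ⊂ X, hence invariant under isomorphisms of the pair)] -/
theorem IsBlochSemiregular.comp_iso {n p : ℕ} (h : IsBlochSemiregular i n p) :
    IsBlochSemiregular (i ≫ e.hom.left) n p :=
  fun r m k hp hn hk => blochPairingMap_surjective_comp_iso e i r (m + 1) k (h r m k hp hn hk)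

end CompIso

end Literature.AlgebraicGeometry.HodgeTheory

end
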